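import Literature.Analysis.FluidPDE.BurgersVortexSteady
import Literature.Analysis.FluidPDE.ClassicalTopPointCubic
import Literature.Analysis.FluidPDE.SereginSverakBlowupSelection
import Literature.Analysis.FluidPDE.EnstrophyGronwall
import Literature.Analysis.FluidPDE.Wei2016FarFieldPointwise
import Summits.NavierStokesRegularity.NavierStokesRegularity.Theorems.SwirlDecrementLawBurgers
import HarnessLib.Audit
import HarnessLib

/-!
# SwirlDecrementLaw, part 3 — the Burgers witness HOLDS: `BurgersWitnessWith (4π/3)` (ROUND-14 T-14.2b)

Support kernel for the DORMANT route `SwirlThreshold` (crux stmt-NavierStokesRegularity-2002) and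
ladder C of planner nsreg-p2's ROUND-13/14.  ROUND-14 packaged the classical facts about the steady
Burgers vortex as ONE hypothesis `BurgersWitnessWith D` (`…Theorems.SwirlDecrementLaw`, part 2) and
refuted, modulo it, every polynomial one-scale swirl decrement law and every exponential law with
exponent `θ < 1/2`.  This file DISCHARGES the cheap witness `D = 4π/3`, so those refutations become
unconditional (`not_polyDecrementLaw`, `not_expDecrementLaw`).  The tree already held the Burgers
vortex as an exact steady Navier–Stokes solution (`burgersVortex γ ν Γ = axisymmetricStrain γ +
burgersVortexSwirl γ ν Γ`, `burgersVortex_isSteadyClassicalNS`; Burgers 1948, Frisch 1995 §8.9.1,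
Gallay–Maekawa 2016 (1.21)); the memo's field `s(−x₁/2, −x₂/2, x₃) + (G(1−e^{−sr²/4})/r²)(−x₂, x₁, 0)`
is `burgersVortex s 1 (2πG)`; for `S ≥ 8` take `s = 16 S`, `G = 1/s`.
Contents: `isSuitableWeakSolutionInBall_of_steady` (steady smooth solutions are suitable in every
parabolic ball: `isSuitableWeakSolutionInBall_of_classical'` + boundedness on the compact closed
ball); `swirl_burgersVortex` (`(Γ/2π)(1 − e^{−γr²/4ν})`), `isAxisymmetric_burgersVortex`,
`isAxisymmetricScalar_burgersVortexPressure`, `norm_sq_burgersVortex_le`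
(`‖u(x)‖² ≤ (γ² + (γΓ/8πν)²)‖x‖²`); `cknA_witness_le` (`A(z_B,1/4) ≤ (4π/3)S² + 1`,
`EuclideanSpace.volume_ball_fin_three`), `swirl_witness_mem_Icc`, `swirl_witness_not_confined`
(a.e. ⇒ everywhere for the continuous swirl, `SereginSverak2009.forall_le_of_ae_le_of_continuousOn`;
axis point and `(t₀, ρe₀)`, `ρ ↑ 1/16`); `burgersWitnessWith_four_pi_div_three`.
WHAT THIS IS NOT: not NS regularity — an explicit steady solution calibrating a method family from
below; the sharp `D = 2π/5` (`BurgersWitness`) is not attempted (the refutations hold for every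
`D ≥ 0`); hard cores untouched; no crux claim.
-/

noncomputable section

namespace Summit.NavierStokesRegularity.NavierStokesRegularity.Theorems.SwirlDecrementLawBurgersWitness

open MeasureTheory Set Filter Topology Metric Function
open scoped ENNReal NNReal
open Literature.Analysis.FluidPDE Literature.Analysis.FluidPDE.ChenTsaiZhang2022
open Summit.NavierStokesRegularity.NavierStokesRegularity.Theorems.SwirlDecrementLaw

/-! ### Steady smooth solutions on `ℝ³` are suitable weak solutions in every parabolic ball -/

/-- **A steady classical solution on the whole space is a suitable weak solution in every
parabolic ball** `Q_r(z)` (`IsSuitableWeakSolutionInBall`): classical on the open cylinder, the three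
global classes from boundedness of smooth fields on the compact closed ball. -/
theorem isSuitableWeakSolutionInBall_of_steady
    {u : EuclideanSpace ℝ (Fin 3) → EuclideanSpace ℝ (Fin 3)} {p : EuclideanSpace ℝ (Fin 3) → ℝ}
    (h : IsSteadyClassicalNS 1 0 u p) (r : ℝ) (z : ℝ × EuclideanSpace ℝ (Fin 3)) :
    IsSuitableWeakSolutionInBall r z (fun _ => u) (fun _ => p) := by
  -- classical on the open cylinder
  have hcl : IsClassicalNSSolutionOn (univ : Set ℝ) 1 (fun _ => (0 : EuclideanSpace ℝ (Fin 3) →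
      EuclideanSpace ℝ (Fin 3))) (fun _ => u) (fun _ => p) := isSteadyClassicalNS_iff_const.1 h
  have hreg : IsClassicalNSSolutionOnRegion (parabolicCylinder r z) 1 0 (fun _ => u) (fun _ => p) := by
    have h1 := hcl.onRegion
    rw [univ_prod_univ] at h1
    exact h1.mono_of_isOpen (subset_univ _) (isOpen_parabolicCylinder r z)
  -- the compact closed ball containing the space section
  set K : Set (EuclideanSpace ℝ (Fin 3)) := closedBall z.2 |r| with hK
  have hKc : IsCompact K := isCompact_closedBall _ _
  have hballK : ball z.2 r ⊆ K := ball_subset_closedBall.trans (closedBall_subset_closedBall (le_abs_self r))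
  have hQK : ∀ w ∈ parabolicCylinder r z, w.2 ∈ K := fun w hw =>
    hballK ((mem_parabolicCylinder.1 hw).2)
  have hQmeas : MeasurableSet (parabolicCylinder r z) := (isOpen_parabolicCylinder r z).measurableSet
  have hQfin : volume (parabolicCylinder r z) < ⊤ := (isBounded_parabolicCylinder r z).measure_lt_top
  -- bounds of `u`, `∇u`, `p` on `K`
  obtain ⟨M, hM⟩ := hKc.exists_bound_of_continuousOn h.smooth_velocity.continuous.continuousOn
  obtain ⟨M', hM'⟩ := hKc.exists_bound_of_continuousOn
    (h.smooth_velocity.continuous_fderiv (by simp)).continuousOn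
  obtain ⟨P, hP⟩ := hKc.exists_bound_of_continuousOn h.smooth_pressure.continuous.continuousOn
  -- (i) the energy class
  have hE : ∫⁻ x in ball z.2 r, ‖u x‖ₑ ^ 2 ≤ ENNReal.ofReal (M ^ 2) * volume (ball z.2 r) := by
    calc ∫⁻ x in ball z.2 r, ‖u x‖ₑ ^ 2 ≤ ∫⁻ _ in ball z.2 r, ENNReal.ofReal (M ^ 2) := by
          refine setLIntegral_mono' measurableSet_ball fun x hx => ?_
          rw [← ofReal_norm, ← ENNReal.ofReal_pow (norm_nonneg _)]
          exact ENNReal.ofReal_le_ofReal (pow_le_pow_left₀ (norm_nonneg _) (hM x (hballK hx)) 2)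
      _ = ENNReal.ofReal (M ^ 2) * volume (ball z.2 r) := setLIntegral_const _ _
  have hEtop : ENNReal.ofReal (M ^ 2) * volume (ball z.2 r) ≠ ⊤ :=
    ENNReal.mul_ne_top ENNReal.ofReal_ne_top measure_ball_lt_top.ne
  refine isSuitableWeakSolutionInBall_of_classical' hreg
    (C := (ENNReal.ofReal (M ^ 2) * volume (ball z.2 r)).toNNReal) (fun t _ => ?_) ?_ ?_
  · rw [ENNReal.coe_toNNReal hEtop]
    exact hE
  · -- (ii) the gradient class
    have hb : ∀ w ∈ parabolicCylinder r z,
        ENNReal.ofReal (frobeniusNormSq (fderiv ℝ ((fun _ : ℝ => u) w.1) w.2)) ≤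
          3 * ENNReal.ofReal M' ^ 2 := by
      intro w hw
      refine (ofReal_frobeniusNormSq_le_three_mul_enorm_sq _).trans ?_
      gcongr
      rw [← ofReal_norm]
      exact ENNReal.ofReal_le_ofReal (hM' w.2 (hQK w hw))
    calc ∫⁻ w in parabolicCylinder r z,
          ENNReal.ofReal (frobeniusNormSq (fderiv ℝ ((fun _ : ℝ => u) w.1) w.2))
        ≤ ∫⁻ _ in parabolicCylinder r z, 3 * ENNReal.ofReal M' ^ 2 := setLIntegral_mono' hQmeas hb
      _ = 3 * ENNReal.ofReal M' ^ 2 * volume (parabolicCylinder r z) := setLIntegral_const _ _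
      _ < ⊤ := ENNReal.mul_lt_top (ENNReal.mul_lt_top (by simp)
            (ENNReal.pow_lt_top ENNReal.ofReal_lt_top)) hQfin
  · -- (iii) the pressure class
    haveI : IsFiniteMeasure (volume.restrict (parabolicCylinder r z)) :=
      isFiniteMeasure_restrict.2 hQfin.ne
    have hcont : Continuous (uncurry fun _ : ℝ => p) := h.smooth_pressure.continuous.comp continuous_snd
    have htop : MemLp (uncurry fun _ : ℝ => p) ⊤ (volume.restrict (parabolicCylinder r z)) :=
      memLp_top_of_bound hcont.aestronglyMeasurable P
        (ae_restrict_of_forall_mem hQmeas fun w hw => hP w.2 (hQK w hw))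
    exact htop.mono_exponent le_top

/-! ### The Burgers vortex: swirl, symmetry, size -/

/-- **The swirl of the Burgers vortex**: `Γ(x) = x₀ u₁ − x₁ u₀ = (Γ/2π)(1 − e^{−γ r²/(4ν)})`
(the strain has no swirl; the azimuthal part `c φ(t) J x` contributes `c φ(t) r² = (Γ/2π) t φ(t)`,
`t = γr²/4ν`, and `t φ(t) = 1 − e^{−t}`). -/
theorem swirl_burgersVortex (γ ν Γ : ℝ) (x : EuclideanSpace ℝ (Fin 3)) :
    swirl (burgersVortex γ ν Γ) x =
      Γ / (2 * Real.pi) * (1 - Real.exp (-(γ * (x 0 ^ 2 + x 1 ^ 2) / (4 * ν)))) := by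
  rw [← mul_burgersPhi]
  simp only [swirl, burgersVortex, Pi.add_apply, burgersVortexSwirl, axisymmetricStrain,
    PiLp.add_apply, PiLp.smul_apply, smul_eq_mul, linearStrain_apply_zero, linearStrain_apply_one,
    rotGen_apply_zero, rotGen_apply_one]
  ring

/-- The axisymmetric strain is axisymmetric. -/
theorem isAxisymmetric_axisymmetricStrain (γ : ℝ) : IsAxisymmetric (axisymmetricStrain γ) := by
  intro θ x
  ext i
  fin_cases i <;> simp [axisymmetricStrain, rotZ_apply_zero, rotZ_apply_one] <;> ring

/-- The Burgers swirl velocity is axisymmetric. -/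
theorem isAxisymmetric_burgersVortexSwirl (γ ν Γ : ℝ) : IsAxisymmetric (burgersVortexSwirl γ ν Γ) := by
  intro θ x
  have hr : (rotZ θ x) 0 ^ 2 + (rotZ θ x) 1 ^ 2 = x 0 ^ 2 + x 1 ^ 2 := by
    rw [← cylRadius_sq, ← cylRadius_sq, cylRadius_rotZ]
  simp only [burgersVortexSwirl, hr, rotGen_rotZ]
  ext i
  fin_cases i <;> simp [rotZ_apply_zero, rotZ_apply_one] <;> ring

/-- **The Burgers vortex is axisymmetric.** -/
theorem isAxisymmetric_burgersVortex (γ ν Γ : ℝ) : IsAxisymmetric (burgersVortex γ ν Γ) := by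
  intro θ x
  simp only [burgersVortex, Pi.add_apply, isAxisymmetric_axisymmetricStrain γ θ x,
    isAxisymmetric_burgersVortexSwirl γ ν Γ θ x]
  ext i
  fin_cases i <;> simp [rotZ_apply_zero, rotZ_apply_one] <;> ring

/-- **The Burgers pressure is an axisymmetric scalar** (it depends on `x₀² + x₁²` and `x₂` only). -/
theorem isAxisymmetricScalar_burgersVortexPressure (γ ν Γ : ℝ) :
    IsAxisymmetricScalar (burgersVortexPressure γ ν Γ) := by
  intro θ x
  have hr : StrainedAzimuthal.rho (rotZ θ x) = StrainedAzimuthal.rho x := by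
    rw [StrainedAzimuthal.rho_apply, StrainedAzimuthal.rho_apply, ← cylRadius_sq, ← cylRadius_sq,
      cylRadius_rotZ]
  have hn : ‖StrainedAzimuthal.strainL γ (rotZ θ x)‖ ^ 2 = ‖StrainedAzimuthal.strainL γ x‖ ^ 2 := by
    rw [EuclideanSpace.norm_sq_eq, EuclideanSpace.norm_sq_eq]
    simp only [Fin.sum_univ_three, Real.norm_eq_abs, sq_abs]
    have e : ∀ y : EuclideanSpace ℝ (Fin 3), ∀ i, StrainedAzimuthal.strainL γ y i = axisymmetricStrain γ y i :=
      fun y i => rfl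
    simp only [e, axisymmetricStrain, linearStrain_apply_zero, linearStrain_apply_one,
      linearStrain_apply_two, rotZ_apply_zero, rotZ_apply_one, rotZ_apply_two]
    nlinarith [Real.sin_sq_add_cos_sq θ]
  simp only [burgersVortexPressure, StrainedAzimuthal.pressure, hr, hn]

/-- The components of the Burgers vortex. -/
theorem burgersVortex_apply (γ ν Γ : ℝ) (x : EuclideanSpace ℝ (Fin 3)) :
    burgersVortex γ ν Γ x 0 = -γ / 2 * x 0 -
        γ * Γ / (8 * Real.pi * ν) * burgersPhi (γ * (x 0 ^ 2 + x 1 ^ 2) / (4 * ν)) * x 1 ∧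
      burgersVortex γ ν Γ x 1 = -γ / 2 * x 1 +
        γ * Γ / (8 * Real.pi * ν) * burgersPhi (γ * (x 0 ^ 2 + x 1 ^ 2) / (4 * ν)) * x 0 ∧
      burgersVortex γ ν Γ x 2 = γ * x 2 := by
  simp only [burgersVortex, Pi.add_apply, burgersVortexSwirl, axisymmetricStrain, PiLp.add_apply,
    PiLp.smul_apply, smul_eq_mul, linearStrain_apply_zero, linearStrain_apply_one,
    linearStrain_apply_two, rotGen_apply_zero, rotGen_apply_one, rotGen_apply_two]
  exact ⟨by ring, trivial, by ring⟩

/-- **Pointwise size of the Burgers vortex** (`γ ≥ 0`, `ν > 0`):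
`‖u(x)‖² ≤ (γ² + (γΓ/(8πν))²) ‖x‖²` (strain `≤ γ²|x|²`, swirl `c φ(t) J x` with `0 < φ ≤ 1`,
orthogonal to the strain). -/
theorem norm_sq_burgersVortex_le {γ ν : ℝ} (hγ : 0 ≤ γ) (hν : 0 < ν) (Γ : ℝ)
    (x : EuclideanSpace ℝ (Fin 3)) :
    ‖burgersVortex γ ν Γ x‖ ^ 2 ≤ (γ ^ 2 + (γ * Γ / (8 * Real.pi * ν)) ^ 2) * ‖x‖ ^ 2 := by
  obtain ⟨h0, h1, h2⟩ := burgersVortex_apply γ ν Γ x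
  set t : ℝ := γ * (x 0 ^ 2 + x 1 ^ 2) / (4 * ν) with ht
  set c : ℝ := γ * Γ / (8 * Real.pi * ν) with hc
  have hφ0 : 0 < burgersPhi t := burgersPhi_pos t
  have hφ1 : burgersPhi t ≤ 1 := burgersPhi_le_one (by rw [ht]; positivity)
  have hφsq : burgersPhi t ^ 2 ≤ 1 := by nlinarith
  rw [EuclideanSpace.norm_sq_eq, EuclideanSpace.norm_sq_eq]
  simp only [Fin.sum_univ_three, Real.norm_eq_abs, sq_abs, h0, h1, h2]
  have hx0 := sq_nonneg (x 0)
  have hx1 := sq_nonneg (x 1)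
  have hx2 := sq_nonneg (x 2)
  have hc2 := sq_nonneg c
  have hγ2 := sq_nonneg γ
  have key : (-γ / 2 * x 0 - c * burgersPhi t * x 1) ^ 2 + (-γ / 2 * x 1 + c * burgersPhi t * x 0) ^ 2
      + (γ * x 2) ^ 2 = (γ ^ 2 / 4 + c ^ 2 * burgersPhi t ^ 2) * (x 0 ^ 2 + x 1 ^ 2) + γ ^ 2 * x 2 ^ 2 := by
    ring
  rw [key]
  nlinarith [mul_le_mul_of_nonneg_left hφsq hc2, mul_nonneg hc2 (sq_nonneg (burgersPhi t)),
    mul_nonneg hγ2 (add_nonneg hx0 hx1)]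


/-! ### The witness field: strain `s = 16 S`, circulation constant `G = 1/s` -/

/-- The swirl of the witness field `burgersVortex s 1 (2πG)`: `G (1 − e^{−s r²/4})`. -/
theorem swirl_witness {s : ℝ} (hs : s ≠ 0) (x : EuclideanSpace ℝ (Fin 3)) :
    swirl (burgersVortex s 1 (2 * Real.pi * s⁻¹)) x =
      s⁻¹ * (1 - Real.exp (-(s * (x 0 ^ 2 + x 1 ^ 2) / 4))) := by
  rw [swirl_burgersVortex]
  have hπ : Real.pi ≠ 0 := Real.pi_ne_zero
  congr 1
  · field_simp
  · rw [mul_one]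

/-- Pointwise size of the witness field on the ball of radius `1/4`:
`‖u(x)‖² ≤ (s² + 1/16)/16`. -/
theorem norm_sq_witness_le {s : ℝ} (hs : 0 < s) {x : EuclideanSpace ℝ (Fin 3)}
    (hx : x ∈ ball (0 : EuclideanSpace ℝ (Fin 3)) (1 / 4)) :
    ‖burgersVortex s 1 (2 * Real.pi * s⁻¹) x‖ ^ 2 ≤ (s ^ 2 + 1 / 16) / 16 := by
  have hc : s * (2 * Real.pi * s⁻¹) / (8 * Real.pi * 1) = 1 / 4 := by
    have hπ : Real.pi ≠ 0 := Real.pi_ne_zero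
    field_simp
    ring
  have h1 := norm_sq_burgersVortex_le hs.le one_pos (2 * Real.pi * s⁻¹) x
  rw [hc] at h1
  have hxn : ‖x‖ < 1 / 4 := by simpa using hx
  have hxn' : ‖x‖ ^ 2 ≤ (1 / 4) ^ 2 := pow_le_pow_left₀ (norm_nonneg _) hxn.le 2
  calc ‖burgersVortex s 1 (2 * Real.pi * s⁻¹) x‖ ^ 2 ≤ (s ^ 2 + (1 / 4) ^ 2) * ‖x‖ ^ 2 := h1
    _ ≤ (s ^ 2 + (1 / 4) ^ 2) * (1 / 4) ^ 2 := mul_le_mul_of_nonneg_left hxn' (by positivity)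
    _ = (s ^ 2 + 1 / 16) / 16 := by ring

/-- **The scaled energy of the witness at the axis point `z_B` and scale `1/4`**:
`A(z_B, 1/4) ≤ (4π/3) S² + 1` for `s = 16 S > 0` (pointwise bound × `|B_{1/4}| = (4π/3)/64`, × `4`). -/
theorem cknA_witness_le {S : ℝ} (hS : 0 < S) :
    cknA (1 / 4) burgersAxisPoint (fun _ : ℝ => burgersVortex (16 * S) 1 (2 * Real.pi * (16 * S)⁻¹)) ≤
      ENNReal.ofReal (4 * Real.pi / 3 * S ^ 2 + 1) := by
  have hs : 0 < 16 * S := by positivity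
  unfold cknA
  refine iSup₂_le fun t _ => ?_
  have hz : burgersAxisPoint.2 = (0 : EuclideanSpace ℝ (Fin 3)) := rfl
  rw [hz]
  -- the integral over the ball
  have hI : ∫⁻ x in ball (0 : EuclideanSpace ℝ (Fin 3)) (1 / 4),
      ‖burgersVortex (16 * S) 1 (2 * Real.pi * (16 * S)⁻¹) x‖ₑ ^ 2 ≤
      ENNReal.ofReal (((16 * S) ^ 2 + 1 / 16) / 16) * volume (ball (0 : EuclideanSpace ℝ (Fin 3)) (1 / 4)) := by
    calc ∫⁻ x in ball (0 : EuclideanSpace ℝ (Fin 3)) (1 / 4),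
          ‖burgersVortex (16 * S) 1 (2 * Real.pi * (16 * S)⁻¹) x‖ₑ ^ 2
        ≤ ∫⁻ _ in ball (0 : EuclideanSpace ℝ (Fin 3)) (1 / 4), ENNReal.ofReal (((16 * S) ^ 2 + 1 / 16) / 16) := by
          refine setLIntegral_mono' measurableSet_ball fun x hx => ?_
          rw [← ofReal_norm, ← ENNReal.ofReal_pow (norm_nonneg _)]
          exact ENNReal.ofReal_le_ofReal (norm_sq_witness_le hs hx)
      _ = _ := setLIntegral_const _ _
  rw [EuclideanSpace.volume_ball_fin_three] at hI
  have h4 : (ENNReal.ofReal (1 / 4 : ℝ))⁻¹ = ENNReal.ofReal 4 := by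
    rw [← ENNReal.ofReal_inv_of_pos (by norm_num : (0 : ℝ) < 1 / 4)]; norm_num
  rw [h4]
  calc ENNReal.ofReal 4 * ∫⁻ x in ball (0 : EuclideanSpace ℝ (Fin 3)) (1 / 4),
        ‖burgersVortex (16 * S) 1 (2 * Real.pi * (16 * S)⁻¹) x‖ₑ ^ 2
      ≤ ENNReal.ofReal 4 * (ENNReal.ofReal (((16 * S) ^ 2 + 1 / 16) / 16) *
          (ENNReal.ofReal (1 / 4) ^ 3 * ENNReal.ofReal (Real.pi * 4 / 3))) := by
        gcongr
    _ = ENNReal.ofReal (4 * ((((16 * S) ^ 2 + 1 / 16) / 16) * ((1 / 4) ^ 3 * (Real.pi * 4 / 3)))) := by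
        rw [← ENNReal.ofReal_pow (by norm_num : (0 : ℝ) ≤ 1 / 4), ← ENNReal.ofReal_mul (by positivity),
          ← ENNReal.ofReal_mul (by positivity), ← ENNReal.ofReal_mul (by norm_num)]
    _ ≤ ENNReal.ofReal (4 * Real.pi / 3 * S ^ 2 + 1) := by
        refine ENNReal.ofReal_le_ofReal ?_
        have hπ := Real.pi_le_four
        have hπ0 := Real.pi_pos.le
        nlinarith [sq_nonneg S]

/-- **The swirl of the witness is confined to `[0, G(1 − e^{−S/4})]` on `Q(z_B, 1/4)`.** -/
theorem swirl_witness_mem_Icc {S : ℝ} (hS : 0 < S) {x : EuclideanSpace ℝ (Fin 3)}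
    (hx : x ∈ ball (0 : EuclideanSpace ℝ (Fin 3)) (1 / 4)) :
    swirl (burgersVortex (16 * S) 1 (2 * Real.pi * (16 * S)⁻¹)) x ∈
      Icc 0 ((16 * S)⁻¹ * (1 - Real.exp (-(S / 4)))) := by
  have hs : 0 < 16 * S := by positivity
  rw [swirl_witness hs.ne']
  have hxn : ‖x‖ < 1 / 4 := by simpa using hx
  have hr : x 0 ^ 2 + x 1 ^ 2 ≤ (1 / 4) ^ 2 :=
    (Wei2016.sq_add_sq_le_norm_sq x).trans (pow_le_pow_left₀ (norm_nonneg _) hxn.le 2)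
  have hr0 : 0 ≤ x 0 ^ 2 + x 1 ^ 2 := by positivity
  refine ⟨mul_nonneg (inv_nonneg.2 hs.le) ?_, mul_le_mul_of_nonneg_left ?_ (inv_nonneg.2 hs.le)⟩
  · rw [sub_nonneg]
    exact Real.exp_le_one_iff.2 (by rw [neg_nonpos]; positivity)
  · have h1 : S / 4 ≥ 16 * S * (x 0 ^ 2 + x 1 ^ 2) / 4 := by nlinarith
    have h2 : Real.exp (-(S / 4)) ≤ Real.exp (-(16 * S * (x 0 ^ 2 + x 1 ^ 2) / 4)) :=
      Real.exp_le_exp.2 (by linarith)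
    linarith

/-- The swirl of the witness as a continuous space–time function. -/
theorem continuous_swirl_witness {s : ℝ} (hs : s ≠ 0) :
    Continuous fun z : ℝ × EuclideanSpace ℝ (Fin 3) =>
      swirl ((fun _ : ℝ => burgersVortex s 1 (2 * Real.pi * s⁻¹)) z.1) z.2 := by
  simp only [swirl_witness hs]
  fun_prop

/-- **On `Q(z_B, 1/16)` the swirl of the witness is not confined to any interval shorter than
`G(1 − e^{−S/64})`** (a.e. ⇒ everywhere confinement of the continuous swirl; the cylinder contains
`(t₀, 0)` (swirl `0`) and `(t₀, ρ e₀)`, `ρ ↑ 1/16` (swirl `→ G(1 − e^{−S/64})`)). -/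
theorem swirl_witness_not_confined {S : ℝ} (hS : 0 < S) {a' b' : ℝ}
    (h : ∀ᵐ z ∂(volume.restrict (parabolicCylinder (1 / 4 / 4) burgersAxisPoint)),
      swirl ((fun _ : ℝ => burgersVortex (16 * S) 1 (2 * Real.pi * (16 * S)⁻¹)) z.1) z.2 ∈ Icc a' b') :
    (16 * S)⁻¹ * (1 - Real.exp (-(S / 64))) ≤ b' - a' := by
  have hs : 0 < 16 * S := by positivity
  set Q : Set (ℝ × EuclideanSpace ℝ (Fin 3)) := parabolicCylinder (1 / 4 / 4) burgersAxisPoint with hQ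
  have hQopen : IsOpen Q := isOpen_parabolicCylinder _ _
  set f : ℝ × EuclideanSpace ℝ (Fin 3) → ℝ := fun z =>
    swirl ((fun _ : ℝ => burgersVortex (16 * S) 1 (2 * Real.pi * (16 * S)⁻¹)) z.1) z.2 with hf
  have hfc : Continuous f := continuous_swirl_witness hs.ne'
  -- everywhere confinement on the open cylinder
  have hlow : ∀ z ∈ Q, a' ≤ f z :=
    SereginSverak2009.forall_le_of_ae_le_of_continuousOn hQopen continuousOn_const hfc.continuousOn
      (h.mono fun z hz => hz.1)
  have hup : ∀ z ∈ Q, f z ≤ b' :=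
    SereginSverak2009.forall_le_of_ae_le_of_continuousOn hQopen hfc.continuousOn continuousOn_const
      (h.mono fun z hz => hz.2)
  -- the time `t₀ = -1/128 - 1/512` and the points `(t₀, ρ e₀)`
  set t₀ : ℝ := -(1 / 128) - 1 / 512 with ht₀
  have hmem : ∀ ρ : ℝ, |ρ| < 1 / 16 →
      ((t₀, EuclideanSpace.single 0 ρ) : ℝ × EuclideanSpace ℝ (Fin 3)) ∈ Q := by
    intro ρ hρ
    rw [hQ, mem_parabolicCylinder]
    refine ⟨⟨?_, ?_⟩, ?_⟩
    · show burgersAxisPoint.1 - (1 / 4 / 4) ^ 2 < t₀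
      simp only [burgersAxisPoint, ht₀]; norm_num
    · show t₀ < burgersAxisPoint.1
      simp only [burgersAxisPoint, ht₀]; norm_num
    · show dist (EuclideanSpace.single 0 ρ) burgersAxisPoint.2 < 1 / 4 / 4
      have : burgersAxisPoint.2 = (0 : EuclideanSpace ℝ (Fin 3)) := rfl
      rw [this, dist_zero_right, PiLp.norm_single, Real.norm_eq_abs]
      linarith
  -- value of `f` at these points
  have hval : ∀ ρ : ℝ, f (t₀, EuclideanSpace.single 0 ρ) =
      (16 * S)⁻¹ * (1 - Real.exp (-(16 * S * ρ ^ 2 / 4))) := by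
    intro ρ
    simp only [hf, swirl_witness hs.ne', PiLp.single_apply]
    norm_num
  -- `a' ≤ 0` from the axis point
  have ha' : a' ≤ 0 := by
    have h0 := hlow _ (hmem 0 (by norm_num))
    rw [hval] at h0
    simpa using h0
  -- `b' ≥ G (1 - e^{-S/64})` by a limit along `ρ ↑ 1/16`
  have hb' : (16 * S)⁻¹ * (1 - Real.exp (-(S / 64))) ≤ b' := by
    set g : ℝ → ℝ := fun ρ => (16 * S)⁻¹ * (1 - Real.exp (-(16 * S * ρ ^ 2 / 4))) with hg
    have hgc : Continuous g := by rw [hg]; fun_prop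
    have hlim : Tendsto g (𝓝[<] (1 / 16)) (𝓝 (g (1 / 16))) :=
      hgc.continuousAt.tendsto.mono_left nhdsWithin_le_nhds
    have hev : ∀ᶠ ρ in 𝓝[<] (1 / 16 : ℝ), g ρ ≤ b' := by
      filter_upwards [Ioo_mem_nhdsLT (by norm_num : (0 : ℝ) < 1 / 16)] with ρ hρ
      have h1 := hup _ (hmem ρ (by rw [abs_of_pos hρ.1]; exact hρ.2))
      rwa [hval] at h1
    have hle := le_of_tendsto hlim hev
    have e : g (1 / 16) = (16 * S)⁻¹ * (1 - Real.exp (-(S / 64))) := by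
      rw [hg]; ring_nf
    rwa [e] at hle
  linarith

/-! ### The witness -/

/-- **THE BURGERS WITNESS with the cheap energy constant `D = 4π/3` holds** (T-14.2b of planner
nsreg-p2's ROUND-14): for every `S ≥ 8`, the steady Burgers vortex `burgersVortex (16S) 1 (2π/(16S))`
is a suitable weak solution in `Q(1)` with axisymmetric velocity and pressure, scaled energy
`A(z_B, 1/4) ≤ (4π/3) S² + 1`, swirl confined to `[0, G(1 − e^{−S/4})]` on `Q(z_B, 1/4)` and not
confined to any interval shorter than `G(1 − e^{−S/64})` on `Q(z_B, 1/16)`, `G = 1/(16S)`. -/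
theorem burgersWitnessWith_four_pi_div_three : BurgersWitnessWith (4 * Real.pi / 3) := by
  intro S hS8
  have hS : 0 < S := by linarith
  have hs : 0 < 16 * S := by positivity
  have hsteady := burgersVortex_isSteadyClassicalNS one_ne_zero (16 * S) (2 * Real.pi * (16 * S)⁻¹)
  refine ⟨fun _ => burgersVortex (16 * S) 1 (2 * Real.pi * (16 * S)⁻¹),
    fun _ => burgersVortexPressure (16 * S) 1 (2 * Real.pi * (16 * S)⁻¹), (16 * S)⁻¹,
    inv_pos.2 hs, isSuitableWeakSolutionInBall_of_steady hsteady 1 0,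
    fun _ _ => isAxisymmetric_burgersVortex _ _ _,
    fun _ _ => isAxisymmetricScalar_burgersVortexPressure _ _ _, cknA_witness_le hS, ?_,
    fun a' b' hconf => swirl_witness_not_confined hS hconf⟩
  -- a.e. confinement on `Q(z_B, 1/4)` from the pointwise one
  refine ae_restrict_of_forall_mem (isOpen_parabolicCylinder _ _).measurableSet fun z hz => ?_
  have hx : z.2 ∈ ball (0 : EuclideanSpace ℝ (Fin 3)) (1 / 4) := (mem_parabolicCylinder.1 hz).2
  exact swirl_witness_mem_Icc hS hx

/-- **Unconditional**: no polynomial one-scale swirl decrement law, any exponent `p > 0`. -/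
theorem not_polyDecrementLaw {p : ℝ} (hp : 0 < p) : ¬ PolyDecrementLaw p :=
  not_polyDecrementLaw_of_burgersWith (by positivity) burgersWitnessWith_four_pi_div_three hp

/-- No exponential one-scale swirl decrement law with exponent `θ < 1/2` (unconditional). -/
theorem not_expDecrementLaw {θ : ℝ} (hθ : θ < 1 / 2) : ¬ ExpDecrementLaw θ :=
  not_expDecrementLaw_of_burgersWith (by positivity) burgersWitnessWith_four_pi_div_three hθ

end Summit.NavierStokesRegularity.NavierStokesRegularity.Theorems.SwirlDecrementLawBurgersWitness

end
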